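import Summits.PneNP.PneNP.Theorems.ChebyshevTracialDesignMatchingHarmonics
import Summits.PneNP.PneNP.Theorems.ChebyshevTracialDesignInvolutionKeys
import HarnessLib

/-!
# Cell pnp-psdrank, route `ChebyshevTracialDesign`: sums of a harmonic layer over the sets closed under a
# perfect matching — the `B`-scalar `C(n/2 − k, a − k/2)` of the saturation factorisation

Harmonic backbone, brick 4b (MEMO-7 §1 (1e)). A perfect matching is encoded by its partner map, a fixed-point-free
involution `π` of `Fin n`; a vertex set `V` is `π`-CLOSED (`M`-saturated) iff `π V ⊆ V`. For a Johnson-harmonic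
coefficient vector `p` of degree `k` (lit's `JohnsonHarmonics`) we evaluate the sum of the layer function `zeta p` over
the closed sets of size `2a`:
* `closedSum_zeta_eq_zero_of_odd` : it VANISHES for odd `k`;
* `closedSum_zeta_eq_of_even` : for `k = 2κ` with `4κ ≤ n` and `κ ≤ a` it equals
  `C(n/2 − 2κ, a − κ) · Σ_{T = πT, |T| = 2κ} p_T` (the last sum, over the sets made of `κ` matching edges, is MEMO-7's
  `Π_p(M)`; it does not depend on `a`).
Ingredients: the key counting of `…InvolutionKeys` (closed supersets ↔ key sets containing the key-shadow,
`2|E(T)| = 2|T| − d_π(T)`, the alternating binomial identity) and the pairing-recurrence consequences of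
`…MatchingHarmonics` (p437476). This is the matching-side factor of the level kernels of Rothvoß's slack matrix
[cite: Rothvoss2017, §2 (PDF p. 6)]: with the slice ladders (p437052) it gives `A_cᵀ(zeta p) = σ̃_k(c)·Π_p`, i.e. every
level kernel kills the odd Johnson layers and is rank one in `c` on the even ones
[cite: GodsilMeagher2015, §15.2 (perfect matching scheme)]. WHAT THIS IS NOT: the tight spectrum (★★) and the Hoffman
bound are the next brick; nothing on psd rank. Supports crux stmt-PneNP-19878.
-/

set_option linter.dupNamespace false -- `Summit.PneNP.PneNP.…`: summit = sub-problem (D-0017)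

noncomputable section

namespace Summit.PneNP.PneNP.Theorems.ChebyshevTracialDesignMatchingClosedSums

open Finset Literature.Combinatorics.AssociationSchemes Literature.Combinatorics.AssociationSchemes.JohnsonHarmonics
open Summit.PneNP.PneNP.Theorems.ChebyshevTracialDesignMatchingHarmonics
open Summit.PneNP.PneNP.Theorems.ChebyshevTracialDesignSliceLadders
open Summit.PneNP.PneNP.Theorems.ChebyshevTracialDesignInvolutionKeys

variable {n : ℕ}

/-! ### §3 The closed-set sums of a harmonic layer -/

/-- Expanding `zeta` and swapping: `Σ_{V closed, |V| = 2a} zeta p (V) = Σ_T p_T · #{V closed, |V| = 2a, T ⊆ V}`. -/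
theorem closedSum_zeta_eq_sum (π : Fin n → Fin n) (p : Finset (Fin n) → ℝ) (a : ℕ) :
    ∑ V ∈ (powersetCard (2 * a) (univ : Finset (Fin n))).filter (fun V => ∀ x ∈ V, π x ∈ V), zeta p V =
      ∑ T : Finset (Fin n), p T *
        (((powersetCard (2 * a) (univ : Finset (Fin n))).filter (fun V => (∀ x ∈ V, π x ∈ V) ∧ T ⊆ V)).card : ℝ) := by
  simp only [zeta_apply]
  rw [sum_comm' (t' := univ)
    (s' := fun T => (powersetCard (2 * a) (univ : Finset (Fin n))).filter (fun V => (∀ x ∈ V, π x ∈ V) ∧ T ⊆ V))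
    (h := fun V T => by simp only [mem_filter, mem_powerset, mem_univ]; tauto)]
  refine sum_congr rfl fun T _ => ?_
  rw [sum_const, nsmul_eq_mul, mul_comm]

/-- **Odd degrees: the closed-set sums vanish.** For a fixed-point-free involution `π` and a harmonic `p` of odd
degree `k`: `Σ_{V closed, |V| = 2a} zeta p (V) = 0`. -/
theorem closedSum_zeta_eq_zero_of_odd {π : Fin n → Fin n} (hinv : ∀ x, π (π x) = x) (hfix : ∀ x, π x ≠ x)
    {k : ℕ} (hk : Odd k) {p : Finset (Fin n) → ℝ} (hp : IsHarmonic k p) (a : ℕ) :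
    ∑ V ∈ (powersetCard (2 * a) (univ : Finset (Fin n))).filter (fun V => ∀ x ∈ V, π x ∈ V), zeta p V = 0 := by
  classical
  rw [closedSum_zeta_eq_sum]
  -- group by the class `d_π(T) = d`; on the support the count depends on `T` only through `d`
  set N := ((univ : Finset (Fin n)).filter (fun x => x < π x)).card with hN
  let G : ℕ → ℝ := fun d => if (2 * k - d) / 2 ≤ a then (((N - (2 * k - d) / 2).choose (a - (2 * k - d) / 2) : ℕ) : ℝ) else 0
  have hterm : ∀ T : Finset (Fin n), p T *
      (((powersetCard (2 * a) (univ : Finset (Fin n))).filter (fun V => (∀ x ∈ V, π x ∈ V) ∧ T ⊆ V)).card : ℝ) =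
      p T * G (T.filter (fun x => π x ∈ T)).card := by
    intro T
    by_cases hTk : T.card = k
    · rw [card_closed_supersets_eq_choose hinv hfix T a]
      have hE := two_mul_card_keyShadow hinv hfix T
      rw [hTk] at hE
      have hEeq : ((T ∪ T.image π).filter (fun x => x < π x)).card = (2 * k - (T.filter (fun x => π x ∈ T)).card) / 2 := by
        omega
      simp only [G, ← hEeq, ← hN]
    · rw [hp.1 T hTk, zero_mul, zero_mul]
  rw [sum_congr rfl fun T _ => hterm T]
  -- split by classes
  have hsplit : ∑ T : Finset (Fin n), p T * G (T.filter (fun x => π x ∈ T)).card =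
      ∑ d ∈ range (n + 1), ∑ T ∈ univ.filter (fun T : Finset (Fin n) => (T.filter (fun x => π x ∈ T)).card = d),
        p T * G (T.filter (fun x => π x ∈ T)).card := by
    rw [← sum_biUnion]
    · refine (sum_subset (subset_univ _) fun T _ hT => ?_).symm
      exfalso; apply hT
      rw [mem_biUnion]
      refine ⟨(T.filter (fun x => π x ∈ T)).card, mem_range.2 ?_, by simp⟩
      have := (card_filter_le T (fun x => π x ∈ T)).trans (card_finset_fin_le T)
      omega
    · intro i _ j _ hij
      exact disjoint_filter.2 fun T _ h1 h2 => hij (h1.symm.trans h2)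
  rw [hsplit]
  refine sum_eq_zero fun d _ => ?_
  have hcl : ∑ T ∈ univ.filter (fun T : Finset (Fin n) => (T.filter (fun x => π x ∈ T)).card = d),
      p T * G (T.filter (fun x => π x ∈ T)).card =
      G d * ∑ T ∈ univ.filter (fun T : Finset (Fin n) => (T.filter (fun x => π x ∈ T)).card = d), p T := by
    rw [mul_sum]
    refine sum_congr rfl fun T hT => ?_
    simp only [mem_filter, mem_univ, true_and] at hT
    rw [hT, mul_comm]
  rw [hcl, pairedSum_eq_zero_of_odd hinv hfix hk hp d, mul_zero]

/-- **Even degrees: the `B`-scalar.** For a fixed-point-free involution `π` of `Fin n`, a harmonic `p` of degree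
`2κ` with `4κ ≤ n`, and `κ ≤ a`:
`Σ_{V closed, |V| = 2a} zeta p (V) = C(n/2 − 2κ, a − κ) · Σ_{T closed, |T| = 2κ} p_T`
(the last sum is over the sets made of `κ` pairs of `π`; `n/2` = the number of keys). -/
theorem closedSum_zeta_eq_of_even {π : Fin n → Fin n} (hinv : ∀ x, π (π x) = x) (hfix : ∀ x, π x ≠ x)
    {κ : ℕ} (hκn : 4 * κ ≤ n) {p : Finset (Fin n) → ℝ} (hp : IsHarmonic (2 * κ) p) {a : ℕ} (hκa : κ ≤ a) :
    ∑ V ∈ (powersetCard (2 * a) (univ : Finset (Fin n))).filter (fun V => ∀ x ∈ V, π x ∈ V), zeta p V =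
      (((((univ : Finset (Fin n)).filter (fun x => x < π x)).card - 2 * κ).choose (a - κ) : ℕ) : ℝ) *
        ∑ T ∈ univ.filter (fun T : Finset (Fin n) => (T.filter (fun x => π x ∈ T)).card = 2 * κ), p T := by
  classical
  rw [closedSum_zeta_eq_sum]
  set N := ((univ : Finset (Fin n)).filter (fun x => x < π x)).card with hN
  have hNn : 2 * N = n := two_mul_card_keys hinv hfix
  set k := 2 * κ with hk
  let G : ℕ → ℝ := fun d => if (2 * k - d) / 2 ≤ a then (((N - (2 * k - d) / 2).choose (a - (2 * k - d) / 2) : ℕ) : ℝ) else 0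
  have hterm : ∀ T : Finset (Fin n), p T *
      (((powersetCard (2 * a) (univ : Finset (Fin n))).filter (fun V => (∀ x ∈ V, π x ∈ V) ∧ T ⊆ V)).card : ℝ) =
      p T * G (T.filter (fun x => π x ∈ T)).card := by
    intro T
    by_cases hTk : T.card = k
    · rw [card_closed_supersets_eq_choose hinv hfix T a]
      have hE := two_mul_card_keyShadow hinv hfix T
      rw [hTk] at hE
      have hEeq : ((T ∪ T.image π).filter (fun x => x < π x)).card = (2 * k - (T.filter (fun x => π x ∈ T)).card) / 2 := by
        omega
      simp only [G, ← hEeq, ← hN]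
    · rw [hp.1 T hTk, zero_mul, zero_mul]
  rw [sum_congr rfl fun T _ => hterm T]
  -- split by classes `d ∈ [0, n]`
  have hsplit : ∑ T : Finset (Fin n), p T * G (T.filter (fun x => π x ∈ T)).card =
      ∑ d ∈ range (n + 1), ∑ T ∈ univ.filter (fun T : Finset (Fin n) => (T.filter (fun x => π x ∈ T)).card = d),
        p T * G (T.filter (fun x => π x ∈ T)).card := by
    rw [← sum_biUnion]
    · refine (sum_subset (subset_univ _) fun T _ hT => ?_).symm
      exfalso; apply hT
      rw [mem_biUnion]
      refine ⟨(T.filter (fun x => π x ∈ T)).card, mem_range.2 ?_, by simp⟩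
      have := (card_filter_le T (fun x => π x ∈ T)).trans (card_finset_fin_le T)
      omega
    · intro i _ j _ hij
      exact disjoint_filter.2 fun T _ h1 h2 => hij (h1.symm.trans h2)
  rw [hsplit]
  have hcl : ∀ d, ∑ T ∈ univ.filter (fun T : Finset (Fin n) => (T.filter (fun x => π x ∈ T)).card = d),
      p T * G (T.filter (fun x => π x ∈ T)).card =
      G d * ∑ T ∈ univ.filter (fun T : Finset (Fin n) => (T.filter (fun x => π x ∈ T)).card = d), p T := by
    intro d
    rw [mul_sum]
    refine sum_congr rfl fun T hT => ?_
    simp only [mem_filter, mem_univ, true_and] at hT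
    rw [hT, mul_comm]
  simp only [hcl]
  -- odd classes and classes above `k` contribute nothing; even classes `d = 2s`, `s ≤ κ`, by the closed form
  have hodd_empty : ∀ d, ¬ 2 ∣ d →
      ∑ T ∈ univ.filter (fun T : Finset (Fin n) => (T.filter (fun x => π x ∈ T)).card = d), p T = 0 := by
    intro d hd
    refine sum_eq_zero fun T hT => ?_
    simp only [mem_filter, mem_univ, true_and] at hT
    by_cases hTk : T.card = k
    · exfalso
      have hE := two_mul_card_keyShadow hinv hfix T
      rw [hT, hTk, hk] at hE
      omega
    · exact hp.1 T hTk
  have hbig : ∀ d, k < d →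
      ∑ T ∈ univ.filter (fun T : Finset (Fin n) => (T.filter (fun x => π x ∈ T)).card = d), p T = 0 := by
    intro d hd
    refine sum_eq_zero fun T hT => ?_
    simp only [mem_filter, mem_univ, true_and] at hT
    by_cases hTk : T.card = k
    · exfalso
      have := card_filter_le T (fun x => π x ∈ T)
      rw [hT, hTk] at this
      omega
    · exact hp.1 T hTk
  -- reduce the `d`-sum to `d = 2s`, `s ≤ κ`
  have hreindex : ∑ d ∈ range (n + 1),
      G d * ∑ T ∈ univ.filter (fun T : Finset (Fin n) => (T.filter (fun x => π x ∈ T)).card = d), p T =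
      ∑ s ∈ range (κ + 1),
        G (2 * s) * ∑ T ∈ univ.filter (fun T : Finset (Fin n) => (T.filter (fun x => π x ∈ T)).card = 2 * s), p T := by
    -- the map `s ↦ 2s` from `range (κ+1)` into `range (n+1)` hits exactly the nonzero terms
    symm
    refine sum_of_injOn (fun s => 2 * s) (fun s _ t _ h => by simpa using h) ?_ ?_ (fun s _ => rfl)
    · intro s hs
      simp only [coe_range, Set.mem_Iio] at hs ⊢
      omega
    · intro d hd hnot
      simp only [Set.mem_image, coe_range, Set.mem_Iio, not_exists, not_and] at hnot
      by_cases h2 : 2 ∣ d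
      · obtain ⟨s, rfl⟩ := h2
        have hs : κ < s := by
          by_contra hle
          exact hnot s (by push Not at hle; omega) rfl
        rw [hbig (2 * s) (by omega), mul_zero]
      · rw [hodd_empty d h2, mul_zero]
  rw [hreindex]
  -- closed form in each even class, then the alternating binomial identity
  have hclass : ∀ s ∈ range (κ + 1),
      G (2 * s) * ∑ T ∈ univ.filter (fun T : Finset (Fin n) => (T.filter (fun x => π x ∈ T)).card = 2 * s), p T =
      ((-1 : ℝ) ^ (κ - s) * (κ.choose (κ - s) : ℝ) *
        (if κ - s ≤ a - κ then ((((N - κ) - (κ - s)).choose ((a - κ) - (κ - s)) : ℕ) : ℝ) else 0)) *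
        ∑ T ∈ univ.filter (fun T : Finset (Fin n) => (T.filter (fun x => π x ∈ T)).card = 2 * κ), p T := by
    intro s hs
    have hsκ : s ≤ κ := by have := mem_range.1 hs; omega
    rw [pairedSum_eq_of_even hinv hfix hp hsκ, Nat.choose_symm hsκ]
    have hG : G (2 * s) = if κ - s ≤ a - κ then ((((N - κ) - (κ - s)).choose ((a - κ) - (κ - s)) : ℕ) : ℝ) else 0 := by
      simp only [G, hk]
      have e1 : (2 * (2 * κ) - 2 * s) / 2 = 2 * κ - s := by omega
      rw [e1]
      by_cases h : 2 * κ - s ≤ a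
      · rw [if_pos h, if_pos (by omega)]
        have e2 : N - (2 * κ - s) = N - κ - (κ - s) := by omega
        have e3 : a - (2 * κ - s) = a - κ - (κ - s) := by omega
        rw [e2, e3]
      · rw [if_neg h, if_neg (by omega)]
    rw [hG]; ring
  rw [sum_congr rfl hclass, ← sum_mul]
  congr 1
  -- reindex `j = κ - s` and apply the alternating identity with `A = N - κ`, `B = a - κ`
  have hN2 : κ ≤ N - κ := by omega
  rw [show N - k = N - κ - κ by omega, ← alternating_choose_sum κ (N - κ) (a - κ) hN2]
  refine sum_nbij' (fun s => κ - s) (fun j => κ - j) ?_ ?_ ?_ ?_ ?_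
  · intro s hs; simp only [mem_range] at hs ⊢; omega
  · intro j hj; simp only [mem_range] at hj ⊢; omega
  · intro s hs; simp only [mem_range] at hs; show κ - (κ - s) = s; omega
  · intro j hj; simp only [mem_range] at hj; show κ - (κ - j) = j; omega
  · intro s hs
    rfl

end Summit.PneNP.PneNP.Theorems.ChebyshevTracialDesignMatchingClosedSums
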